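import Mathlib.Analysis.Calculus.BumpFunction.Normed
import Mathlib.Analysis.Calculus.BumpFunction.InnerProduct
import Mathlib.Analysis.Calculus.ContDiff.Deriv
import Mathlib.MeasureTheory.Integral.IntervalIntegral.FundThmCalculus
import Literature.Analysis.Calculus.HardyExterior
import HarnessLib

/-!
# Hardy's inequality outside a ball for `C¹` functions vanishing at infinity

(namespace `Literature.Analysis.Calculus`; companion of `HardyExterior.lean` and `HardyExteriorDecay.lean`.)

`HardyExterior.lean` proves Hardy's inequality outside a ball,
`∫_{‖y‖ > R} u²/‖y‖² ≤ (2/(n − 2))² ∫_{‖y‖ > R} ‖Du‖²` (`n = dim E ≥ 3`, `R > 0`), for `u ∈ C¹_c(E)`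
(`hardy_sq_integral_exterior_le`); `HardyExteriorDecay.lean` extends it to `u ∈ C¹({‖y‖ > R₀})`
under either the a-priori finiteness of the left side (`hardy_sq_lintegral_exterior_le_of_integrable`)
or the decay rate `‖y‖ |u(y)| ≤ C₀` (`hardy_sq_lintegral_exterior_le_of_decay`). This file treats the
class that steady Liouville problems actually provide — NO rate and NO a-priori integrability: the
same inequality holds, in `ℝ≥0∞`-valued form (the right-hand side may be infinite), for every
`u ∈ C¹(E)` which merely **tends to `0` at infinity** (`Tendsto u (cocompact E) (𝓝 0)`), with the same
sharp constant (`hardy_sq_lintegral_exterior_le_of_tendsto_cocompact`). This is the form in which the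
inequality is used for velocity fields of finite Dirichlet energy vanishing at infinity (steady
Navier–Stokes Liouville problems: Galdi 2011, §II.6–II.7 and Thm. X.9.5; the whole-space div–curl
identity of `Literature/Analysis/FluidPDE/WholeSpaceDivCurlIdentity.lean`).

Proof (classical truncation argument, e.g. Galdi 2011, proof of Thm. II.6.1): compose `u` with the
`C¹` amplitude truncations `ρ_ε(s) = ∫₀ˢ (1 − b_ε)`, `b_ε` a smooth bump equal to `1` on `[−ε, ε]`
and supported in `(−2ε, 2ε)`; then `ρ_ε ∘ u ∈ C¹_c(E)` (it vanishes where `|u| ≤ ε`, i.e. off a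
compact set), `‖D(ρ_ε ∘ u)‖ ≤ ‖Du‖` pointwise (`|ρ_ε'| ≤ 1`) and `ρ_ε ∘ u → u` pointwise
(`|ρ_ε(s) − s| ≤ 4ε`); apply the compact-support inequality and Fatou's lemma.

Mathlib has no Hardy inequality; the tree's `HardyExterior.lean` / `ExteriorSobolev.lean` treat
compactly supported functions, `HardyExteriorDecay.lean` functions with a decay rate or with the left
side already finite (searched `hardy`, `cocompact`, `truncation`).

## References

* G. P. Galdi, *An Introduction to the Mathematical Theory of the Navier–Stokes Equations.
  Steady-State Problems*, 2nd ed., Springer (2011), Thm. II.6.1 (functions with `∇u ∈ L^q`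
  and their behaviour at infinity; truncation argument) and (II.6.10)–(II.6.13) (Hardy-type
  inequalities). Key `Galdi2011`.
* M. Dafermos, I. Rodnianski, Y. Shlapentokh-Rothman, arXiv:1402.7034 = Ann. of Math. 183 (2016),
  §4.3 (the Hardy inequality of `HardyExterior.lean`).
-/

noncomputable section

open MeasureTheory Set Filter Module Metric
open scoped Topology RealInnerProductSpace ENNReal

namespace Literature.Analysis.Calculus

/-! ### `C¹` amplitude truncations -/

/-- **Smooth amplitude truncation.** For every `ε > 0` there is `ρ ∈ C¹(ℝ)` with `ρ = 0` on
`[−ε, ε]`, `|ρ'| ≤ 1` everywhere and `|ρ(s) − s| ≤ 4ε`: take `ρ(s) = ∫₀ˢ (1 − b)` with `b` a smooth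
bump, `b = 1` on `[−ε, ε]`, `0 ≤ b ≤ 1`, `b = 0` off `(−2ε, 2ε)` (Galdi 2011, proof of Thm. II.6.1,
the cut-off in the range). [cite: Galdi2011, Thm. II.6.1 (proof)] -/
theorem exists_contDiff_truncation {ε : ℝ} (hε : 0 < ε) :
    ∃ ρ : ℝ → ℝ, ContDiff ℝ 1 ρ ∧ (∀ s, |s| ≤ ε → ρ s = 0) ∧ (∀ s, |deriv ρ s| ≤ 1) ∧
      ∀ s, |ρ s - s| ≤ 4 * ε := by
  let b : ContDiffBump (0 : ℝ) := ⟨ε, 2 * ε, hε, by linarith⟩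
  set g : ℝ → ℝ := fun τ => 1 - b τ with hg
  have hgc : Continuous g := continuous_const.sub b.continuous
  have hg01 : ∀ τ, 0 ≤ g τ ∧ g τ ≤ 1 := fun τ =>
    ⟨sub_nonneg.2 b.le_one, by simpa [hg] using b.nonneg' τ⟩
  set ρ : ℝ → ℝ := fun s => ∫ τ in (0 : ℝ)..s, g τ with hρ
  have hderiv : ∀ s, HasDerivAt ρ (g s) s := fun s =>
    intervalIntegral.integral_hasDerivAt_right (hgc.intervalIntegrable _ _)
      (hgc.stronglyMeasurableAtFilter _ _) hgc.continuousAt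
  have hderiv' : deriv ρ = g := funext fun s => (hderiv s).deriv
  refine ⟨ρ, ?_, ?_, ?_, ?_⟩
  · rw [contDiff_one_iff_deriv, hderiv']
    exact ⟨fun s => (hderiv s).differentiableAt, hgc⟩
  · intro s hs
    -- `g = 0` on `[-|s|, |s|] ⊆ [-ε, ε]`
    have hzero : ∀ τ ∈ uIcc (0 : ℝ) s, g τ = 0 := by
      intro τ hτ
      have hτ' : |τ| ≤ ε := by
        rcases le_total 0 s with h0s | hs0
        · rw [uIcc_of_le h0s] at hτ
          rw [abs_le]; constructor <;> [linarith [hτ.1]; linarith [hτ.2, le_abs_self s]]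
        · rw [uIcc_of_ge hs0] at hτ
          rw [abs_le]; constructor <;> [linarith [hτ.1, neg_abs_le s]; linarith [hτ.2]]
      have hb1 : b τ = 1 := b.one_of_mem_closedBall (by simpa [b, Real.dist_eq] using hτ')
      simp [hg, hb1]
    show ∫ τ in (0 : ℝ)..s, g τ = 0
    rw [intervalIntegral.integral_congr (g := fun _ => (0 : ℝ)) hzero]
    simp
  · intro s
    rw [hderiv']
    rw [abs_le]
    exact ⟨by linarith [(hg01 s).1], (hg01 s).2⟩
  · intro s
    -- `ρ s - s = -∫₀ˢ b`, and `|∫₀ˢ b| ≤ ∫_ℝ b ≤ |[-2ε, 2ε]| = 4ε`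
    have hbi : Integrable b := b.integrable
    have hρs : ρ s - s = -∫ τ in (0 : ℝ)..s, b τ := by
      show (∫ τ in (0 : ℝ)..s, g τ) - s = -∫ τ in (0 : ℝ)..s, b τ
      have h1 : ∫ τ in (0 : ℝ)..s, g τ = (∫ _τ in (0 : ℝ)..s, (1 : ℝ)) - ∫ τ in (0 : ℝ)..s, b τ := by
        rw [← intervalIntegral.integral_sub (continuous_const.intervalIntegrable _ _)
          (b.continuous.intervalIntegrable _ _)]
      rw [h1, intervalIntegral.integral_const, smul_eq_mul, mul_one, sub_zero]
      ring
    have htot : ∫ τ, b τ ≤ 4 * ε := by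
      have h := b.integral_le_measure_closedBall (μ := volume)
      have hvol : (volume : Measure ℝ).real (closedBall (0 : ℝ) b.rOut) = 4 * ε := by
        rw [Measure.real, Real.volume_closedBall, ENNReal.toReal_ofReal (by positivity)]
        show 2 * (2 * ε) = 4 * ε
        ring
      rwa [hvol] at h
    have habs : |∫ τ in (0 : ℝ)..s, b τ| ≤ ∫ τ, b τ := by
      rcases le_total 0 s with h0s | hs0
      · rw [intervalIntegral.integral_of_le h0s,
          abs_of_nonneg (setIntegral_nonneg measurableSet_Ioc fun τ _ => b.nonneg' τ)]
        exact setIntegral_le_integral hbi (Eventually.of_forall fun τ => b.nonneg' τ)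
      · rw [intervalIntegral.integral_of_ge hs0, abs_neg,
          abs_of_nonneg (setIntegral_nonneg measurableSet_Ioc fun τ _ => b.nonneg' τ)]
        exact setIntegral_le_integral hbi (Eventually.of_forall fun τ => b.nonneg' τ)
    rw [hρs, abs_neg]
    exact habs.trans htot


/-! ### Hardy's inequality for `C¹` functions tending to zero at infinity -/

variable {E : Type*} [NormedAddCommGroup E] [InnerProductSpace ℝ E] [FiniteDimensional ℝ E]
  [MeasurableSpace E] [BorelSpace E]

/-- **Hardy's inequality outside a ball, for `C¹` functions vanishing at infinity.** Let `E` be a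
real inner product space of dimension `n ≥ 3`, `u ∈ C¹(E)` with `u(y) → 0` as `‖y‖ → ∞`, and
`R > 0`. Then `∫_{‖y‖ > R} u²/‖y‖² ≤ (2/(n − 2))² ∫_{‖y‖ > R} ‖Du‖²` as an inequality in `[0, ∞]`
(no integrability assumed; if `∫_{‖y‖>R} ‖Du‖² < ∞` the left side is finite). Truncate in the
range (`exists_contDiff_truncation`), apply the compactly supported case
`hardy_sq_integral_exterior_le`, and pass to the limit by Fatou's lemma (Galdi 2011, Thm. II.6.1
and (II.6.10)–(II.6.13); the compactly supported inequality is that of `HardyExterior.lean`).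
[cite: Galdi2011, Thm. II.6.1 and (II.6.10)–(II.6.13)] -/
theorem hardy_sq_lintegral_exterior_le_of_tendsto_cocompact {u : E → ℝ} (hu : ContDiff ℝ 1 u)
    (h0 : Tendsto u (cocompact E) (𝓝 0)) {R : ℝ} (hR : 0 < R) (hn : 3 ≤ finrank ℝ E) :
    ∫⁻ y in {y : E | R < ‖y‖}, ENNReal.ofReal (u y ^ 2 / ‖y‖ ^ 2) ≤
      ENNReal.ofReal ((2 / ((finrank ℝ E : ℝ) - 2)) ^ 2) *
        ∫⁻ y in {y : E | R < ‖y‖}, ENNReal.ofReal (‖fderiv ℝ u y‖ ^ 2) := by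
  set S : Set E := {y | R < ‖y‖} with hS
  have hSm : MeasurableSet S := (isOpen_lt continuous_const continuous_norm).measurableSet
  have hyS : ∀ y, y ∈ S ↔ R < ‖y‖ := fun y => Iff.rfl
  set C : ℝ := (2 / ((finrank ℝ E : ℝ) - 2)) ^ 2 with hC
  -- truncations at the levels `ε_k = 1/(k+1)`
  have hε : ∀ k : ℕ, (0 : ℝ) < 1 / ((k : ℝ) + 1) := fun k => by positivity
  choose ρ hρC hρ0 hρd hρs using fun k : ℕ => exists_contDiff_truncation (hε k)
  set w : ℕ → E → ℝ := fun k y => ρ k (u y) with hw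
  have huc : Continuous u := hu.continuous
  have hwC : ∀ k, ContDiff ℝ 1 (w k) := fun k => (hρC k).comp hu
  have hwc : ∀ k, Continuous (w k) := fun k => (hwC k).continuous
  -- compact support: `|u| < ε_k` off a compact set, where `w k` vanishes
  have hwsupp : ∀ k, HasCompactSupport (w k) := by
    intro k
    have hev : ∀ᶠ y in cocompact E, dist (u y) 0 < 1 / ((k : ℝ) + 1) :=
      h0.eventually (Metric.ball_mem_nhds (0 : ℝ) (hε k))
    obtain ⟨K, hK, hKsub⟩ := mem_cocompact.1 hev
    refine HasCompactSupport.intro hK fun y hy => ?_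
    have h1 : |u y| < 1 / ((k : ℝ) + 1) := by simpa [Real.dist_eq] using hKsub hy
    exact hρ0 k (u y) h1.le
  -- the chain rule: `‖D(w k)‖ ≤ ‖Du‖`
  have hDw : ∀ k y, ‖fderiv ℝ (w k) y‖ ≤ ‖fderiv ℝ u y‖ := by
    intro k y
    have h1 : HasFDerivAt (w k) ((deriv (ρ k) (u y)) • fderiv ℝ u y) y :=
      (((hρC k).differentiable one_ne_zero) (u y)).hasDerivAt.comp_hasFDerivAt y
        ((hu.differentiable one_ne_zero) y).hasFDerivAt
    rw [h1.fderiv, norm_smul, Real.norm_eq_abs]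
    calc |deriv (ρ k) (u y)| * ‖fderiv ℝ u y‖ ≤ 1 * ‖fderiv ℝ u y‖ := by
          gcongr
          exact hρd k (u y)
      _ = ‖fderiv ℝ u y‖ := one_mul _
  -- the compactly supported Hardy inequality for each truncation, in `ℝ≥0∞`
  have hRS : ∀ y ∈ S, R ^ 2 < ‖y‖ ^ 2 := fun y hy =>
    pow_lt_pow_left₀ ((hyS y).1 hy) hR.le two_ne_zero
  have hk : ∀ k, ∫⁻ y in S, ENNReal.ofReal (w k y ^ 2 / ‖y‖ ^ 2) ≤
      ENNReal.ofReal C * ∫⁻ y in S, ENNReal.ofReal (‖fderiv ℝ u y‖ ^ 2) := by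
    intro k
    have hH := hardy_sq_integral_exterior_le (hwC k) (hwsupp k) hR hn
    -- integrability of the two integrands of the truncation
    have hi1 : Integrable (fun y => w k y ^ 2 / ‖y‖ ^ 2) (volume.restrict S) := by
      have hg : Integrable fun y : E => (R ^ 2)⁻¹ * w k y ^ 2 :=
        (((hwc k).pow 2).integrable_of_hasCompactSupport
          (HasCompactSupport.intro (hwsupp k) fun y hy => by
            simp [image_eq_zero_of_notMem_tsupport hy])).const_mul _
      refine Integrable.mono' hg.integrableOn ?_ (ae_restrict_of_forall_mem hSm fun y hy => ?_)
      · exact (((hwc k).measurable.pow_const 2).div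
          (continuous_norm.measurable.pow_const 2)).aestronglyMeasurable
      · rw [Real.norm_eq_abs, abs_of_nonneg (div_nonneg (sq_nonneg _) (sq_nonneg _)),
          div_eq_inv_mul]
        have hRy : R ^ 2 ≤ ‖y‖ ^ 2 := (hRS y hy).le
        have hR2 : 0 < R ^ 2 := by positivity
        exact mul_le_mul_of_nonneg_right ((inv_le_inv₀ (hR2.trans_le hRy) hR2).2 hRy)
          (sq_nonneg _)
    have hi2 : Integrable (fun y => ‖fderiv ℝ (w k) y‖ ^ 2) (volume.restrict S) :=
      (((continuous_norm.comp ((hwC k).continuous_fderiv one_ne_zero)).pow 2)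
        |>.integrable_of_hasCompactSupport (HasCompactSupport.intro (hwsupp k) fun y hy => by
          simp [fderiv_of_notMem_tsupport ℝ hy])).integrableOn
    calc ∫⁻ y in S, ENNReal.ofReal (w k y ^ 2 / ‖y‖ ^ 2)
        = ENNReal.ofReal (∫ y in S, w k y ^ 2 / ‖y‖ ^ 2) :=
          (ofReal_integral_eq_lintegral_ofReal hi1
            (ae_of_all _ fun y => div_nonneg (sq_nonneg _) (sq_nonneg _))).symm
      _ ≤ ENNReal.ofReal (C * ∫ y in S, ‖fderiv ℝ (w k) y‖ ^ 2) := ENNReal.ofReal_le_ofReal hH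
      _ = ENNReal.ofReal C * ∫⁻ y in S, ENNReal.ofReal (‖fderiv ℝ (w k) y‖ ^ 2) := by
          rw [ENNReal.ofReal_mul (by positivity),
            ofReal_integral_eq_lintegral_ofReal hi2 (ae_of_all _ fun y => sq_nonneg _)]
      _ ≤ ENNReal.ofReal C * ∫⁻ y in S, ENNReal.ofReal (‖fderiv ℝ u y‖ ^ 2) := by
          gcongr with y
          exact hDw k y
  -- Fatou: `w k → u` pointwise
  have hlim : ∀ y, Tendsto (fun k => ENNReal.ofReal (w k y ^ 2 / ‖y‖ ^ 2)) atTop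
      (𝓝 (ENNReal.ofReal (u y ^ 2 / ‖y‖ ^ 2))) := by
    intro y
    have hwy : Tendsto (fun k => w k y) atTop (𝓝 (u y)) := by
      have hεk : Tendsto (fun k : ℕ => 4 * (1 / ((k : ℝ) + 1))) atTop (𝓝 0) := by
        simpa using (tendsto_one_div_add_atTop_nhds_zero_nat).const_mul (4 : ℝ)
      refine (tendsto_iff_norm_sub_tendsto_zero.2 ?_)
      exact squeeze_zero (fun k => norm_nonneg _) (fun k => by
        simpa [Real.norm_eq_abs] using hρs k (u y)) hεk
    exact ENNReal.tendsto_ofReal (((hwy.pow 2).div_const _))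
  have hmeas : ∀ k, Measurable fun y => ENNReal.ofReal (w k y ^ 2 / ‖y‖ ^ 2) := fun k =>
    (((hwc k).measurable.pow_const 2).div (continuous_norm.measurable.pow_const 2)).ennreal_ofReal
  calc ∫⁻ y in S, ENNReal.ofReal (u y ^ 2 / ‖y‖ ^ 2)
      = ∫⁻ y in S, liminf (fun k => ENNReal.ofReal (w k y ^ 2 / ‖y‖ ^ 2)) atTop :=
        lintegral_congr fun y => ((hlim y).liminf_eq).symm
    _ ≤ liminf (fun k => ∫⁻ y in S, ENNReal.ofReal (w k y ^ 2 / ‖y‖ ^ 2)) atTop :=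
        lintegral_liminf_le hmeas
    _ ≤ ENNReal.ofReal C * ∫⁻ y in S, ENNReal.ofReal (‖fderiv ℝ u y‖ ^ 2) := by
        refine (liminf_le_liminf (Eventually.of_forall hk)).trans ?_
        rw [liminf_const]

end Literature.Analysis.Calculus
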